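import Summits.QuantumFields.YangMills.Theorems.SwapVirialDeficitNearFlatCoaxialProjection
import HarnessLib

/-!
# THE B-TUBE IS LIPSCHITZ-CLOSE TO STRATUM B: small σ-words in the tube ⟹ an explicit stratum-B point at LINEAR cost
# (free-hands support of ⟨stmt-QuantumFields-24197⟩ `SwapVirialDeficit.SwapGluedStiffness`; ➎ plan of record memo7 §C(c)∕§E(3): the FAR FLOOR of the
# (S-B) law `stub_B_stiff` — w2 g59 2026-08-31 20:29Z «REMAINING for stub_B_stiff after K7e: the far floor (w3-type GLOBAL floor over base_B, LEAD 19:34Z)» —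
# wants `relations² ≳ k(τ)·dist(·, B)²` on the tube, i.e. the LIPSCHITZ (not Hölder) near-flat projection onto stratum B away from the crossing `Σ`)

Letters of ✓`…NearFlatSigmaWords` ∕ ✓`…NearFlatCoaxialProjection`: pure unit axis `v`, unit seam `c` with A-weight `P = ‖c_∥‖²` and B-weight `Q = ‖c_⊥‖²`,
coaxial unit triple `C_μ = r_μ + t_μ·v`, `A = |C₁ − C₀|²`, `B = |C₁ − C̄₀|²`, `W = ‖cC₁ − C₀c‖² + ‖cC₀ − C₁c‖² + ‖cC₂ − C₂c‖² = 2AP + (2B + 4t₂²)Q`.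
IN THE TUBE — `Q ≥ ½` (the seam is B-heavy: `|re c|` and the component of `im c` along the axis are small) and `t₀² ≥ κ > 0` (the heavy leader `C₀` is
uniformly non-central: transverse modulus `≥ τ`) — the casework of ✓`nearFlat_real_casework` becomes LINEAR: `B ≤ 2W`, `t₂² ≤ W`, and once `W ≤ κ/2` also
`A ≥ κ` (`|t₁ − t₀| ≥ 2|t₀| − |t₁ + t₀| ≥ √κ`), hence `P ≤ W/(2κ)`.  So:
* `tube_real_casework` — the three linear bounds;
* ★★ `exists_stratumB_near_of_coax_tube` — for `W ≤ ρ²`, `ρ² ≤ κ/2` and any `ε ≥ 0` with `2ρ² ≤ ε²`, `ρ² ≤ 2κε²`: an EXPLICIT stratum-B tuple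
  `(c′, C₀, C̄₀, σ₂)` — `c′` a pure unit ANTICOMMUTING with the axis (`c′v = −vc′`), `C̄₀ = r₀ − t₀v`, `σ₂ = ±1` — with `‖c − c′‖ ≤ 4ε`, `C₀` UNMOVED,
  `‖C₁ − C̄₀‖ ≤ 4ε`, `‖C₂ − σ₂‖ ≤ 4ε`, together with its flatness relations (`c′C̄₀ = C₀c′`, `c′C₀ = C̄₀c′`, `c′σ₂ = σ₂c′`); e.g. `ε = ρ·(2 + 1/√κ)` works,
  so the move is LINEAR in `√W` with constant `≲ 1/√κ ≍ 1/τ`;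
* ★ `exists_flat_near_of_coax_tube` — the same packaged as an exactly flat unit tuple (the hypotheses of ✓`flat_of_sigma_relations`).
Far from flat (`W > κ/2`) nothing is claimed: there the far floor is the constant `κ/2` itself.  The coaxialization of `C₁, C₂` at the heavy `C₀` (cost
`‖[C₀, C_k]‖/‖im C₀‖ ≤ ‖[C₀, C_k]‖/√κ`, ✓`exists_coaxial_tuple`) and the transfer of `W` (✓`sigma_residual_lipschitz`, ✓`comm_lipschitz`) are Lipschitz with the
same constant, so on the tube `dist(·, B) ≤ K(τ)·√(relations²)` with `K(τ) = O(1/τ)`; the transfer to the fibre letters `(δ, x₀, y, z, η_F)` of ✓`BTube` is the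
consumer's (w2∕w3).

HONEST LABEL: elementary quaternion geometry; stubs B ∕ core ∕ 001 of skeleton ➎, ⟨24197⟩ ∕ ⟨24194⟩ ∕ ⟨24497⟩ OPEN; own crux ⟨22884⟩ `LargeFieldMassRefinementTail`
OPEN (blocked-on ⟨19935⟩); the Yang–Mills mass gap is NOT proved; no summit is proved by a line.  THEOREMS ONLY (0 `def`, 0 `sorry`), standard axioms.
LEAD seat ym-line-sfw-p2 g99 (cell ym-idea-1, free hands), `--supports stmt-QuantumFields-24197`.  References: [folklore].
-/

set_option autoImplicit false

noncomputable section

open Quaternion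
open scoped Quaternion RealInnerProductSpace
open Summit.QuantumFields.YangMills.Theorems.VirialFluxGap.AnchorSlice (norm_coe_add_smul_pure_sq)

namespace Summit.QuantumFields.YangMills.Theorems.SwapVirialDeficit.NearFlat

/-- THE LINEAR CASEWORK IN THE TUBE: `Q ≥ ½`, `t₀² ≥ κ`, `2(AP + BQ) + 4t₂²Q ≤ W ≤ κ/2` (`A = (r₁−r₀)² + (t₁−t₀)²`, `B = (r₁−r₀)² + (t₁+t₀)²`, `P ≥ 0`)
⟹ `B ≤ 2W`, `t₂² ≤ W` and `2κP ≤ W` (since then `A ≥ t₀² ≥ κ`). [folklore] -/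
theorem tube_real_casework {P Q r₀ t₀ r₁ t₁ t₂ κ W : ℝ} (hP0 : 0 ≤ P) (hQ : 1 / 2 ≤ Q) (hκ : κ ≤ t₀ ^ 2) (hWκ : W ≤ κ / 2)
    (hW : ((r₁ - r₀) ^ 2 + (t₁ - t₀) ^ 2) * P + ((r₁ - r₀) ^ 2 + (t₁ + t₀) ^ 2) * Q +
      (((r₁ - r₀) ^ 2 + (t₁ - t₀) ^ 2) * P + ((r₁ - r₀) ^ 2 + (t₁ + t₀) ^ 2) * Q) + 4 * t₂ ^ 2 * Q ≤ W) :
    (r₁ - r₀) ^ 2 + (t₁ + t₀) ^ 2 ≤ 2 * W ∧ t₂ ^ 2 ≤ W ∧ 2 * κ * P ≤ W := by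
  have hA0 : 0 ≤ (r₁ - r₀) ^ 2 + (t₁ - t₀) ^ 2 := by positivity
  have hB0 : 0 ≤ (r₁ - r₀) ^ 2 + (t₁ + t₀) ^ 2 := by positivity
  have hAP : 0 ≤ ((r₁ - r₀) ^ 2 + (t₁ - t₀) ^ 2) * P := mul_nonneg hA0 hP0
  have hBQ : ((r₁ - r₀) ^ 2 + (t₁ + t₀) ^ 2) * (1 / 2) ≤ ((r₁ - r₀) ^ 2 + (t₁ + t₀) ^ 2) * Q := mul_le_mul_of_nonneg_left hQ hB0
  have htQ : 4 * t₂ ^ 2 * (1 / 2) ≤ 4 * t₂ ^ 2 * Q := mul_le_mul_of_nonneg_left hQ (by positivity)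
  have ht0 : 0 ≤ t₂ ^ 2 := sq_nonneg _
  have hB : (r₁ - r₀) ^ 2 + (t₁ + t₀) ^ 2 ≤ 2 * W := by nlinarith
  have ht₂ : t₂ ^ 2 ≤ W := by nlinarith
  refine ⟨hB, ht₂, ?_⟩
  -- `(t₁ + t₀)² ≤ 2W ≤ κ ≤ t₀²`, and `(t₁ − t₀)² = 2t₁² + 2t₀² − (t₁ + t₀)² ≥ t₀² ≥ κ`
  have hsum : (t₁ + t₀) ^ 2 ≤ t₀ ^ 2 := by nlinarith [sq_nonneg (r₁ - r₀)]
  have hid : (t₁ - t₀) ^ 2 = 2 * t₁ ^ 2 + 2 * t₀ ^ 2 - (t₁ + t₀) ^ 2 := by ring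
  have hA : κ ≤ (r₁ - r₀) ^ 2 + (t₁ - t₀) ^ 2 := by nlinarith [sq_nonneg (r₁ - r₀), sq_nonneg t₁]
  have hBQ0 : 0 ≤ ((r₁ - r₀) ^ 2 + (t₁ + t₀) ^ 2) * Q := mul_nonneg hB0 (by linarith)
  have htQ0 : 0 ≤ 4 * t₂ ^ 2 * Q := by nlinarith [sq_nonneg t₂]
  have hAP2 : 2 * (((r₁ - r₀) ^ 2 + (t₁ - t₀) ^ 2) * P) ≤ W := by linarith
  nlinarith [mul_le_mul_of_nonneg_right hA hP0]

/-- ★★ **THE TUBE IS LIPSCHITZ-CLOSE TO STRATUM B.**  Pure unit axis `v`, unit seam `c` with B-weight `Q ≥ ½`, coaxial unit triple `C_μ = r_μ + t_μ·v` with the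
heavy leader uniformly non-central (`0 < κ ≤ t₀²`), and σ-words `W ≤ ρ² ≤ κ/2`; then for every `ε ≥ 0` with `2ρ² ≤ ε²` and `ρ² ≤ 2κε²` there is an explicit
STRATUM-B tuple `(c′, C₀, C̄₀, σ₂)` — `c′` a pure unit anticommuting with the axis, `C̄₀ = r₀ − t₀·v`, `σ₂ = ±1` — within `4ε`: `‖c − c′‖ ≤ 4ε`, `‖C₁ − C̄₀‖ ≤ 4ε`,
`‖C₂ − σ₂‖ ≤ 4ε` (`C₀` unmoved), with the flatness relations `c′C̄₀ = C₀c′`, `c′C₀ = C̄₀c′`, `c′σ₂ = σ₂c′`. [folklore] -/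
theorem exists_stratumB_near_of_coax_tube {v : ℍ} (hv : v.re = 0) (hv1 : ‖v‖ = 1) {c : ℍ} (hc : ‖c‖ = 1) {r₀ t₀ r₁ t₁ r₂ t₂ : ℝ}
    (h2 : r₂ ^ 2 + t₂ ^ 2 = 1) {κ ρ ε : ℝ} (hκ0 : 0 < κ) (hκ : κ ≤ t₀ ^ 2) (hQ : 1 / 2 ≤ ‖c.im‖ ^ 2 - ⟪c.im, v⟫ ^ 2)
    (hW : ‖c * ((r₁ : ℍ) + t₁ • v) - ((r₀ : ℍ) + t₀ • v) * c‖ ^ 2 + ‖c * ((r₀ : ℍ) + t₀ • v) - ((r₁ : ℍ) + t₁ • v) * c‖ ^ 2 +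
        ‖c * ((r₂ : ℍ) + t₂ • v) - ((r₂ : ℍ) + t₂ • v) * c‖ ^ 2 ≤ ρ ^ 2)
    (hρκ : ρ ^ 2 ≤ κ / 2) (hε : 0 ≤ ε) (hε1 : 2 * ρ ^ 2 ≤ ε ^ 2) (hε2 : ρ ^ 2 ≤ 2 * κ * ε ^ 2) :
    ∃ (c' : ℍ) (σ₂ : ℝ), ‖c'‖ = 1 ∧ c'.re = 0 ∧ c' * v = -(v * c') ∧ σ₂ ^ 2 = 1 ∧
      c' * ((r₀ : ℍ) + (-t₀) • v) = ((r₀ : ℍ) + t₀ • v) * c' ∧ c' * ((r₀ : ℍ) + t₀ • v) = ((r₀ : ℍ) + (-t₀) • v) * c' ∧ c' * (σ₂ : ℍ) = (σ₂ : ℍ) * c' ∧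
      ‖c - c'‖ ≤ 4 * ε ∧ ‖((r₁ : ℍ) + t₁ • v) - ((r₀ : ℍ) + (-t₀) • v)‖ ≤ 4 * ε ∧ ‖((r₂ : ℍ) + t₂ • v) - (σ₂ : ℍ)‖ ≤ 4 * ε := by
  -- the σ-words in the letters `P, Q, A, B, t₂`
  have hP0 : 0 ≤ c.re ^ 2 + ⟪c.im, v⟫ ^ 2 := by positivity
  have e01 := sq_norm_sigmaWord_coax_unit hv hv1 c r₀ t₀ r₁ t₁
  have e10 : ‖c * ((r₀ : ℍ) + t₀ • v) - ((r₁ : ℍ) + t₁ • v) * c‖ ^ 2 =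
      ((r₁ - r₀) ^ 2 + (t₁ - t₀) ^ 2) * (c.re ^ 2 + ⟪c.im, v⟫ ^ 2) + ((r₁ - r₀) ^ 2 + (t₁ + t₀) ^ 2) * (‖c.im‖ ^ 2 - ⟪c.im, v⟫ ^ 2) := by
    rw [sq_norm_sigmaWord_coax_unit hv hv1]; ring
  have e2 := sq_norm_comm_coax_unit hv hv1 c r₂ t₂
  rw [e01, e10, e2] at hW
  clear e01 e10 e2
  obtain ⟨hB, ht₂, hP⟩ := tube_real_casework hP0 hQ hκ hρκ hW
  have hQpos : 0 < ‖c.im‖ ^ 2 - ⟪c.im, v⟫ ^ 2 := by linarith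
  have hPε : c.re ^ 2 + ⟪c.im, v⟫ ^ 2 ≤ ε ^ 2 :=
    le_of_mul_le_mul_left (by linarith : 2 * κ * (c.re ^ 2 + ⟪c.im, v⟫ ^ 2) ≤ 2 * κ * ε ^ 2) (by positivity)
  have hBε : (r₁ - r₀) ^ 2 + (t₁ + t₀) ^ 2 ≤ ε ^ 2 := by linarith
  have ht₂ε : t₂ ^ 2 ≤ ε ^ 2 := by nlinarith
  -- the stratum-B projections
  obtain ⟨c', hc'1, hc're, hanti, hdist⟩ := exists_orth_unit_near hv hv1 hc hQpos
  obtain ⟨σ₂, hσ₂, d₂⟩ := exists_central_near_coax hv hv1 h2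
  have hε4 : 0 ≤ 4 * ε := by positivity
  have hsq : Real.sqrt (c.re ^ 2 + ⟪c.im, v⟫ ^ 2) ≤ ε := by
    calc Real.sqrt (c.re ^ 2 + ⟪c.im, v⟫ ^ 2) ≤ Real.sqrt (ε ^ 2) := Real.sqrt_le_sqrt hPε
      _ = ε := Real.sqrt_sq hε
  have dc : ‖c - c'‖ ≤ 4 * ε := hdist.trans (by linarith)
  have d1 : ‖((r₁ : ℍ) + t₁ • v) - ((r₀ : ℍ) + (-t₀) • v)‖ ≤ 4 * ε :=
    norm_le_of_sq_le hε4 (by rw [sq_norm_coax_sub_coax hv hv1, sub_neg_eq_add]; nlinarith)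
  have e₂ : ‖((r₂ : ℍ) + t₂ • v) - (σ₂ : ℍ)‖ ≤ 4 * ε := norm_le_of_sq_le hε4 (by nlinarith)
  exact ⟨c', σ₂, hc'1, hc're, hanti, hσ₂, sigmaRel_of_anticomm hanti r₀ t₀, sigmaRel_of_anticomm' hanti r₀ t₀, (coe_comm σ₂ c').symm, dc, d1, e₂⟩

/-- ★ **The same, packaged as an exactly flat unit tuple** (the hypotheses of ✓`flat_of_sigma_relations` with `Cf = ![C₀, C̄₀, σ₂, c′]`): in the tube, σ-words
`≤ ρ² ≤ κ/2` ⟹ a flat unit tuple within `4ε` for any `ε ≥ 0` with `2ρ² ≤ ε²`, `ρ² ≤ 2κε²` — LINEAR in `ρ`. [folklore] -/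
theorem exists_flat_near_of_coax_tube {v : ℍ} (hv : v.re = 0) (hv1 : ‖v‖ = 1) {c : ℍ} (hc : ‖c‖ = 1) {r₀ t₀ r₁ t₁ r₂ t₂ : ℝ}
    (h0 : r₀ ^ 2 + t₀ ^ 2 = 1) (h2 : r₂ ^ 2 + t₂ ^ 2 = 1) {κ ρ ε : ℝ} (hκ0 : 0 < κ) (hκ : κ ≤ t₀ ^ 2) (hQ : 1 / 2 ≤ ‖c.im‖ ^ 2 - ⟪c.im, v⟫ ^ 2)
    (hW : ‖c * ((r₁ : ℍ) + t₁ • v) - ((r₀ : ℍ) + t₀ • v) * c‖ ^ 2 + ‖c * ((r₀ : ℍ) + t₀ • v) - ((r₁ : ℍ) + t₁ • v) * c‖ ^ 2 +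
        ‖c * ((r₂ : ℍ) + t₂ • v) - ((r₂ : ℍ) + t₂ • v) * c‖ ^ 2 ≤ ρ ^ 2)
    (hρκ : ρ ^ 2 ≤ κ / 2) (hε : 0 ≤ ε) (hε1 : 2 * ρ ^ 2 ≤ ε ^ 2) (hε2 : ρ ^ 2 ≤ 2 * κ * ε ^ 2) :
    ∃ c' C₀' C₁' C₂' : ℍ, ‖c'‖ = 1 ∧ ‖C₀'‖ = 1 ∧ ‖C₁'‖ = 1 ∧ ‖C₂'‖ = 1 ∧
      C₀' * C₁' = C₁' * C₀' ∧ C₀' * C₂' = C₂' * C₀' ∧ C₁' * C₂' = C₂' * C₁' ∧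
      c' * C₁' = C₀' * c' ∧ c' * C₀' = C₁' * c' ∧ c' * C₂' = C₂' * c' ∧
      ‖c - c'‖ ≤ 4 * ε ∧ ‖((r₀ : ℍ) + t₀ • v) - C₀'‖ ≤ 4 * ε ∧ ‖((r₁ : ℍ) + t₁ • v) - C₁'‖ ≤ 4 * ε ∧
        ‖((r₂ : ℍ) + t₂ • v) - C₂'‖ ≤ 4 * ε := by
  obtain ⟨c', σ₂, hc'1, -, -, hσ₂, s₁, s₀, s₂, dc, d1, d2⟩ :=
    exists_stratumB_near_of_coax_tube hv hv1 hc h2 hκ0 hκ hQ hW hρκ hε hε1 hε2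
  have hε4 : 0 ≤ 4 * ε := by positivity
  have d00 : ‖((r₀ : ℍ) + t₀ • v) - ((r₀ : ℍ) + t₀ • v)‖ ≤ 4 * ε := by rw [sub_self, norm_zero]; exact hε4
  have hn1 : ‖(r₀ : ℍ) + (-t₀) • v‖ = 1 := norm_eq_one_of_sq (by rw [norm_coe_add_smul_pure_sq hv hv1, neg_sq, h0])
  exact ⟨c', (r₀ : ℍ) + t₀ • v, (r₀ : ℍ) + (-t₀) • v, (σ₂ : ℍ), hc'1, norm_eq_one_of_sq (by rw [norm_coe_add_smul_pure_sq hv hv1, h0]), hn1,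
    norm_coe_of_sq_eq_one hσ₂, coax_comm v _ _ _ _, (coe_comm σ₂ _).symm, (coe_comm σ₂ _).symm, s₁, s₀, s₂, dc, d00, d1, d2⟩

end Summit.QuantumFields.YangMills.Theorems.SwapVirialDeficit.NearFlat

end
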